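import Literature.NumberTheory.ModularSymbols.FullLevelHomologyCosetClasses
import Literature.NumberTheory.ModularSymbols.FullLevelHomologyHeckeEquivariant
import HarnessLib

/-!
# The Hecke image of a base coset class in `H₁(Γ₀(M), k[GL₂(ℤ/p)])^{T̃}` and its transfer to `Γ_T`:
# `T_q` upstairs ↔ `Σᵢ {∞, (δ⁻¹tᵢδ)∞}` downstairs, `tᵢ = sᵢ⁻¹ γ'ᵢ s_{σ i}`

Topic `Literature/NumberTheory/ModularSymbols`; namespace `Literature.NumberTheory.ModularSymbols.FullLevel`; sequel of
`FullLevelHomologyCosetClasses` (`cosetClass`, `liftCosetChain`, `heckeChainQuot`, dictionary formulas) and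
`FullLevelHomologyHeckeEquivariant` (`heckeTInvariants`).  Definitions with bodies + proved theorems; no named fact, no `sorry`,
no instance, no notation.  This is the REDUCTION of the comparison «`T_q` on the carrier ↔ `T_q` on `H(p²M; k)`» (memo
CARRIER-gen1 §6 (3)) to a purely downstairs identity between modular symbols at level `p²M`; that identity is the instance of
`CuspidalHomologyHeckeRepIndependence.sum_symbol_eq_heckeOp_of_reps` with the representatives `δ⁻¹ sᵢ⁻¹ βᵢ δ` — NOT done here.

* `baseCoset` (`= T̃`), `secRaw`/`sec` (a normalised section `s` of `Γ₀(M) ↠ GL₂(ℤ/p)/T̃`: `s(x)·T̃ = x`, `s(T̃) = 1`),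
  `hcoset i = xᵢ := β̄ᵢT̃`, `heckePermElt_inv_smul_hcoset` (`γ'ᵢ⁻¹xᵢ = x_{σi}` for `γ ∈ Γ_T`),
  **`transferHecke γ i = tᵢ := s(xᵢ)⁻¹ γ'ᵢ s(x_{σ i})`** (= `PermutationCoeff.transferElt`; `tᵢ ∈ Γ_T`, `transferHecke_mem`).
* `baseCycle γ a = [γ] ⊗ aδ_{T̃}` (`componentMap [γ ⊗ a]`), `heckeCycleChain/heckeCycle = Σᵢ [γ'ᵢ] ⊗ aδ_{xᵢ}` (a cycle for
  `γ ∈ Γ_T`), `heckeChainQuot_baseCycle`; **`heckeTInvariants_cosetClass_baseCycle`**: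
  `T_q (cosetClass (baseCycle γ a)) = cosetClass (heckeCycle γ a)`.
* `transferCycleChain = Σᵢ [tᵢ] ⊗ a ∈ C₁(Γ_T, k)`, `symbolPart_heckeCycle`, **`componentMap_transferCycle`**:
  `componentMap [Σᵢ tᵢ ⊗ a] = [heckeCycle γ a]` (explicit degree-one transfer).
* **`torusInvariantsToCuspidal_cosetClass_baseCycle`**: `cosetClass (baseCycle γ a) ↦ a·({∞,(δ⁻¹γδ)∞} ⊗ 1)` and
  **`torusInvariantsToCuspidal_cosetClass_heckeCycle`**: `cosetClass (heckeCycle γ a) ↦ Σᵢ a·({∞,(δ⁻¹tᵢδ)∞} ⊗ 1)`.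
  Hence `T_q` upstairs corresponds downstairs to `{∞,(δ⁻¹γδ)∞} ↦ Σᵢ {∞,(δ⁻¹tᵢδ)∞}` on the images of base coset classes
  (which span the invariants: `exists_cosetClass_eq` + Shapiro).

## References
* G. Shimura, *Introduction to the arithmetic theory of automorphic functions* (1971), §3.1, §8.3 (8.3.2). [Shimura1971]
* K. S. Brown, *Cohomology of Groups* (1982), Ch. III §6, §9 (A)–(B). [Brown1982]
* A. Ash, G. Stevens, Duke Math. J. 53 (1986), §1 (1.2)–(1.4). [AshStevens1986]
* A. W. Knapp, *Elliptic Curves* (1993), Prop. 11.22–11.23. [Knapp1993]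
-/

noncomputable section

namespace Literature.NumberTheory.ModularSymbols

namespace FullLevel

open scoped MatrixGroups TensorProduct
open CategoryTheory CongruenceSubgroup groupHomology Finsupp Matrix
open Literature.Algebra.Homology
open Literature.NumberTheory.EllipticCurves.ModularForms

variable (k : Type) [CommRing k] (p M : ℕ) [Fact p.Prime] (hpM : Nat.Coprime p M)

/-! ### A normalised section of `Γ₀(M) ↠ GL₂(ℤ/p)/T̃` and the transfer elements `tᵢ = sᵢ⁻¹ γ'ᵢ s_{σ i} ∈ Γ_T` -/

/-- The base coset `T̃ ∈ GL₂(ℤ/p)/T̃`. [cite: Brown1982, Ch. III §6] -/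
def baseCoset : GL (Fin 2) (ZMod p) ⧸ diagTorus (ZMod p) :=
  ((1 : GL (Fin 2) (ZMod p)) : GL (Fin 2) (ZMod p) ⧸ diagTorus (ZMod p))

/-- `baseCoset` is the coset of `1`. [cite: Brown1982, Ch. III §6] -/
theorem baseCoset_eq : baseCoset p = ((1 : GL (Fin 2) (ZMod p)) : GL (Fin 2) (ZMod p) ⧸ diagTorus (ZMod p)) := rfl

/-- A raw section of the transitive action (choice). [cite: Brown1982, Ch. III §9] -/
def secRaw (x : GL (Fin 2) (ZMod p) ⧸ diagTorus (ZMod p)) : Gamma0 M :=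
  Classical.choose (redGL_smul_one_surjective p M hpM x)

/-- `secRaw x` carries the base coset to `x`. [cite: Brown1982, Ch. III §9] -/
theorem secRaw_smul (x : GL (Fin 2) (ZMod p) ⧸ diagTorus (ZMod p)) : redGL p M (secRaw p M hpM x) • baseCoset p = x :=
  Classical.choose_spec (redGL_smul_one_surjective p M hpM x)

/-- **The normalised section** `s : GL₂(ℤ/p)/T̃ → Γ₀(M)`: `s(x)·T̃ = x`, `s(T̃) = 1`. [cite: Brown1982, Ch. III §9] -/
def sec (x : GL (Fin 2) (ZMod p) ⧸ diagTorus (ZMod p)) : Gamma0 M :=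
  secRaw p M hpM x * (secRaw p M hpM (baseCoset p))⁻¹

/-- `s(x)·T̃ = x`. [cite: Brown1982, Ch. III §9] -/
theorem sec_smul (x : GL (Fin 2) (ZMod p) ⧸ diagTorus (ZMod p)) : redGL p M (sec p M hpM x) • baseCoset p = x := by
  have h1 : (redGL p M (secRaw p M hpM (baseCoset p)))⁻¹ • baseCoset p = baseCoset p := by
    rw [inv_smul_eq_iff, secRaw_smul]
  rw [sec, map_mul, map_inv, mul_smul, h1, secRaw_smul]

/-- `s(T̃) = 1`. [cite: Brown1982, Ch. III §9] -/
theorem sec_base : sec p M hpM (baseCoset p) = 1 := by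
  rw [sec, mul_inv_cancel]

/-- An element of `Γ_T` fixes the base coset. [cite: Brown1982, Ch. III §6] -/
theorem smul_baseCoset_of_mem_torusLevel {γ : Gamma0 M} (hγ : γ ∈ torusLevel p M) :
    redGL p M γ • baseCoset p = baseCoset p :=
  (PermutationCoeff.mem_stabilizerIn_iff (redGL p M)).1 hγ

variable {q : ℕ} [NeZero q] (hq : q.Prime) (hqp : q ≠ p)

/-- The cosets `xᵢ := β̄ᵢ·T̃`. [cite: Shimura1971, §8.3] -/
def hcoset (i : HeckeIdx M q) : GL (Fin 2) (ZMod p) ⧸ diagTorus (ZMod p) := betaBar p M hq hqp i • baseCoset p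

omit [NeZero q] in
/-- `γ'ᵢ⁻¹ · xᵢ = x_{σ i}` for `γ ∈ Γ_T` (from `γ'ᵢ⁻¹ β̄ᵢ = β̄_{σ i} γ⁻¹`). [cite: Shimura1971, §8.3 p. 237] -/
theorem heckePermElt_inv_smul_hcoset {γ : Gamma0 M} (hγ : γ ∈ torusLevel p M) (i : HeckeIdx M q) :
    (redGL p M (heckePermElt hq γ i))⁻¹ • hcoset p M hq hqp i = hcoset p M hq hqp (heckePerm hq γ i) := by
  rw [hcoset, hcoset, ← mul_smul, redGL_heckePermElt_inv_mul_betaBar, mul_smul]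
  congr 1
  rw [inv_smul_eq_iff, smul_baseCoset_of_mem_torusLevel p M hγ]

/-- **The transfer elements** `tᵢ := s(xᵢ)⁻¹ γ'ᵢ s(x_{σ i})` of `γ ∈ Γ_T` (the `PermutationCoeff.transferElt` of `γ'ᵢ` at
`xᵢ` for the section `s`). [cite: Brown1982, Ch. III §9 (A); Shimura1971, §8.3] -/
def transferHecke (γ : Gamma0 M) (i : HeckeIdx M q) : Gamma0 M :=
  (sec p M hpM (hcoset p M hq hqp i))⁻¹ * heckePermElt hq γ i * sec p M hpM (hcoset p M hq hqp (heckePerm hq γ i))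

omit [NeZero q] in
/-- `tᵢ` is the generic transfer element `t(γ'ᵢ, xᵢ)`. [cite: Brown1982, Ch. III §9 (A)] -/
theorem transferHecke_eq_transferElt {γ : Gamma0 M} (hγ : γ ∈ torusLevel p M) (i : HeckeIdx M q) :
    transferHecke p M hpM hq hqp γ i =
      PermutationCoeff.transferElt (redGL p M) (sec p M hpM) (heckePermElt hq γ i) (hcoset p M hq hqp i) := by
  rw [transferHecke, PermutationCoeff.transferElt, map_inv, heckePermElt_inv_smul_hcoset p M hq hqp hγ]

omit [NeZero q] in
/-- `tᵢ ∈ Γ_T`. [cite: Brown1982, Ch. III §9 (A)] -/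
theorem transferHecke_mem {γ : Gamma0 M} (hγ : γ ∈ torusLevel p M) (i : HeckeIdx M q) :
    transferHecke p M hpM hq hqp γ i ∈ torusLevel p M := by
  rw [transferHecke_eq_transferElt p M hpM hq hqp hγ, torusLevel]
  have h := PermutationCoeff.transferElt_mem (redGL p M) (fun _ => baseCoset p) (sec p M hpM) (sec_smul p M hpM)
    (fun _ _ => rfl) (heckePermElt hq γ i) (hcoset p M hq hqp i)
  exact h

/-! ### The Hecke image of the base coset cycle `[γ] ⊗ a δ_{T̃}` and its transfer to `Γ_T` -/

/-- The base coset cycle `[γ] ⊗ a δ_{T̃}` of `γ ∈ Γ_T` (the chain of `componentMap [γ ⊗ a]`). [cite: Brown1982, Ch. III §6 (6.3)] -/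
def baseCycle (γ : torusLevel p M) (a : k) :
    cycles₁ (PermutationCoeff.permRepObj k (redGL p M) (GL (Fin 2) (ZMod p) ⧸ diagTorus (ZMod p))) :=
  ⟨single γ.1 (single (baseCoset p) a), PermutationCoeff.single_single_mem_cycles₁ k (redGL p M) (baseCoset p) γ.2 a⟩

/-- `[baseCycle γ a] = componentMap [γ ⊗ a]`. [cite: Brown1982, Ch. III §6 (6.3)] -/
theorem componentMap_single_eq_baseCycle (γ : torusLevel p M) (a : k) :
    PermutationCoeff.componentMap k (redGL p M) (baseCoset p)
        (H1π (Rep.trivial k (torusLevel p M) k) ((cycles₁IsoOfIsTrivial (Rep.trivial k (torusLevel p M) k)).inv (single γ a))) =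
      H1π _ (baseCycle k p M γ a) :=
  PermutationCoeff.componentMap_H1π_single k (redGL p M) (baseCoset p) γ a

/-- The Hecke image chain `Σᵢ [γ'ᵢ] ⊗ a δ_{xᵢ}` of the base coset cycle. [cite: Shimura1971, §8.3 (8.3.2)] -/
def heckeCycleChain (γ : Gamma0 M) (a : k) :
    Gamma0 M →₀ PermutationCoeff.permRepObj k (redGL p M) (GL (Fin 2) (ZMod p) ⧸ diagTorus (ZMod p)) :=
  ∑ i : HeckeIdx M q, single (heckePermElt hq γ i) (single (hcoset p M hq hqp i) a)

/-- `T_q^{quot}([γ] ⊗ aδ_{T̃}) = Σᵢ [γ'ᵢ] ⊗ a δ_{xᵢ}`. [cite: Shimura1971, §8.3 (8.3.2)] -/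
theorem heckeChainQuot_baseCycle (γ : torusLevel p M) (a : k) :
    heckeChainQuot k p M hq hqp (baseCycle k p M γ a).1 = heckeCycleChain k p M hq hqp γ.1 a := by
  rw [baseCycle, heckeChainQuot_single, heckeCycleChain]
  refine Finset.sum_congr rfl fun i _ => ?_
  rw [lmapDomain_apply, mapDomain_single]
  rfl

/-- The Hecke image chain is a cycle (for `γ ∈ Γ_T`: `γ'ᵢ⁻¹xᵢ = x_{σi}` and `σ` is a bijection). [cite: Shimura1971, §8.3] -/
theorem heckeCycleChain_mem_cycles₁ (γ : torusLevel p M) (a : k) :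
    heckeCycleChain k p M hq hqp γ.1 a ∈ cycles₁ (PermutationCoeff.permRepObj k (redGL p M) (GL (Fin 2) (ZMod p) ⧸ diagTorus (ZMod p))) := by
  change (d₁₀ _).hom (heckeCycleChain k p M hq hqp γ.1 a) = 0
  rw [heckeCycleChain, map_sum]
  have e : ∀ i : HeckeIdx M q, (d₁₀ (PermutationCoeff.permRepObj k (redGL p M) (GL (Fin 2) (ZMod p) ⧸ diagTorus (ZMod p)))).hom
      (single (heckePermElt hq γ.1 i) (single (hcoset p M hq hqp i) a)) =
      single (hcoset p M hq hqp (heckePerm hq γ.1 i)) a - single (hcoset p M hq hqp i) a := fun i => by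
    rw [d₁₀_single (A := PermutationCoeff.permRepObj k (redGL p M) (GL (Fin 2) (ZMod p) ⧸ diagTorus (ZMod p)))]
    show PermutationCoeff.permRep k (redGL p M) _ _ _ - _ = _
    rw [PermutationCoeff.permRep_single, map_inv, heckePermElt_inv_smul_hcoset p M hq hqp γ.2]
  rw [Finset.sum_congr rfl (fun i _ => e i), Finset.sum_sub_distrib, sub_eq_zero]
  exact Equiv.sum_comp (heckePermEquiv hq γ.1) (fun j => single (hcoset p M hq hqp j) a)

/-- The Hecke image cycle of the base coset cycle. [cite: Shimura1971, §8.3 (8.3.2)] -/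
def heckeCycle (γ : torusLevel p M) (a : k) :
    cycles₁ (PermutationCoeff.permRepObj k (redGL p M) (GL (Fin 2) (ZMod p) ⧸ diagTorus (ZMod p))) :=
  ⟨heckeCycleChain k p M hq hqp γ.1 a, heckeCycleChain_mem_cycles₁ k p M hq hqp γ a⟩

/-- The transferred `1`-chain `Σᵢ [tᵢ] ⊗ a ∈ C₁(Γ_T, k)`. [cite: Brown1982, Ch. III §9 (A)] -/
def transferCycleChain (γ : torusLevel p M) (a : k) : torusLevel p M →₀ k :=
  ∑ i : HeckeIdx M q, single ⟨transferHecke p M hpM hq hqp γ.1 i, transferHecke_mem p M hpM hq hqp γ.2 i⟩ a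

/-- The transfer `symbolPart` of the Hecke image cycle is `Σᵢ [tᵢ] ⊗ aδ_{T̃}`. [cite: Brown1982, Ch. III §9 (A)] -/
theorem symbolPart_heckeCycle (γ : torusLevel p M) (a : k) :
    PermutationCoeff.symbolPart (redGL p M) (fun _ => baseCoset p) (sec p M hpM) (heckeCycle k p M hq hqp γ a).1 =
      ∑ i : HeckeIdx M q, single (transferHecke p M hpM hq hqp γ.1 i) (single (baseCoset p) a) := by
  show PermutationCoeff.symbolPart (redGL p M) (fun _ => baseCoset p) (sec p M hpM) (heckeCycleChain k p M hq hqp γ.1 a) = _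
  rw [heckeCycleChain, map_sum]
  refine Finset.sum_congr rfl fun i _ => ?_
  rw [PermutationCoeff.symbolPart_single_single, transferHecke_eq_transferElt p M hpM hq hqp γ.2]

/-- The chain of `componentMap [Σᵢ tᵢ ⊗ a]` is `Σᵢ [tᵢ] ⊗ aδ_{T̃}`. [cite: Brown1982, Ch. III §6 (6.3)] -/
theorem coe_mapCycles₁_transferCycle (γ : torusLevel p M) (a : k) :
    (mapCycles₁ (A := Rep.trivial k (torusLevel p M) k)
        (B := PermutationCoeff.permRepObj k (redGL p M) (GL (Fin 2) (ZMod p) ⧸ diagTorus (ZMod p)))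
        (torusLevel p M).subtype (PermutationCoeff.toPermHom k (redGL p M) (baseCoset p))
        ((cycles₁IsoOfIsTrivial (Rep.trivial k (torusLevel p M) k)).inv (transferCycleChain k p M hpM hq hqp γ a))).1 =
      ∑ i : HeckeIdx M q, single (transferHecke p M hpM hq hqp γ.1 i) (single (baseCoset p) a) := by
  rw [coe_mapCycles₁, cycles₁IsoOfIsTrivial_inv_apply, transferCycleChain, map_sum]
  refine Finset.sum_congr rfl fun i _ => ?_
  simp only [ModuleCat.hom_ofHom, LinearMap.coe_comp, Function.comp_apply, lmapDomain_apply,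
    mapDomain_single, mapRange.linearMap_apply, mapRange_single, Subgroup.coe_subtype]
  rfl

/-- **The Hecke image cycle transfers to `Σᵢ [tᵢ] ⊗ a`**: `componentMap [Σᵢ tᵢ ⊗ a] = [Σᵢ γ'ᵢ ⊗ aδ_{xᵢ}]`
(the explicit degree-one transfer `symbolPart` of `GroupHomologyPermutationModuleGenerators`). [cite: Brown1982, Ch. III §9 (A)–(B)] -/
theorem componentMap_transferCycle (γ : torusLevel p M) (a : k) :
    PermutationCoeff.componentMap k (redGL p M) (baseCoset p)
        (H1π (Rep.trivial k (torusLevel p M) k)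
          ((cycles₁IsoOfIsTrivial (Rep.trivial k (torusLevel p M) k)).inv (transferCycleChain k p M hpM hq hqp γ a))) =
      H1π _ (heckeCycle k p M hq hqp γ a) := by
  change (groupHomology.map (A := Rep.trivial k (torusLevel p M) k)
      (B := PermutationCoeff.permRepObj k (redGL p M) (GL (Fin 2) (ZMod p) ⧸ diagTorus (ZMod p)))
      (torusLevel p M).subtype (PermutationCoeff.toPermHom k (redGL p M) (baseCoset p)) 1)
      (H1π (Rep.trivial k (torusLevel p M) k)
        ((cycles₁IsoOfIsTrivial (Rep.trivial k (torusLevel p M) k)).inv (transferCycleChain k p M hpM hq hqp γ a))) = _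
  rw [groupHomology.H1π_comp_map_apply (A := Rep.trivial k (torusLevel p M) k)
      (B := PermutationCoeff.permRepObj k (redGL p M) (GL (Fin 2) (ZMod p) ⧸ diagTorus (ZMod p))),
    PermutationCoeff.H1π_eq_H1π_symbolPart (redGL p M) (fun _ => baseCoset p) (sec p M hpM) (sec_smul p M hpM)
      (fun _ _ => rfl) (heckeCycle k p M hq hqp γ a)]
  congr 1
  apply Subtype.ext
  exact (coe_mapCycles₁_transferCycle k p M hpM hq hqp γ a).trans (symbolPart_heckeCycle k p M hpM hq hqp γ a).symm

variable [Fintype (diagTorus (ZMod p))] [Invertible (Fintype.card (diagTorus (ZMod p)) : k)]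

/-- **`T_q` of a base coset class is the coset class of the Hecke image cycle**:
`T_q (cosetClass [γ ⊗ aδ_{T̃}]) = cosetClass (Σᵢ [γ'ᵢ] ⊗ aδ_{xᵢ})`. [cite: Shimura1971, §8.3 (8.3.2)] -/
theorem heckeTInvariants_cosetClass_baseCycle (γ : torusLevel p M) (a : k) :
    heckeTInvariants k p M hq hqp (diagTorus (ZMod p)) (cosetClass k p M (baseCycle k p M γ a)) =
      cosetClass k p M (heckeCycle k p M hq hqp γ a) := by
  apply Subtype.ext
  rw [coe_heckeTInvariants, coe_cosetClass, coe_cosetClass, map_smul, heckeT_H1π]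
  congr 2
  apply Subtype.ext
  show heckeChain k p M hq hqp (liftCosetChain k p M (baseCycle k p M γ a).1) = liftCosetChain k p M (heckeCycle k p M hq hqp γ a).1
  rw [heckeChain_liftCosetChain, heckeChainQuot_baseCycle]
  rfl

/-- **The dictionary on the Hecke image**: `torusInvariantsToCuspidal (cosetClass (heckeCycle γ a)) = Σᵢ a·({∞,(δ⁻¹tᵢδ)∞} ⊗ 1)`.
[cite: AshStevens1986, §1 (1.3)–(1.4); Knapp1993, Prop. 11.22] -/
theorem torusInvariantsToCuspidal_cosetClass_heckeCycle [NeZero M] [NeZero (p ^ 2 * M)] (γ : torusLevel p M) (a : k) :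
    torusInvariantsToCuspidal k p M hpM (cosetClass k p M (heckeCycle k p M hq hqp γ a)) =
      ∑ i : HeckeIdx M q, a • Literature.NumberTheory.ModularSymbols.symbol (p ^ 2 * M) k
        (torusLevelEquiv p M hpM ⟨transferHecke p M hpM hq hqp γ.1 i, transferHecke_mem p M hpM hq hqp γ.2 i⟩ : Gamma0 (p ^ 2 * M)) := by
  rw [torusInvariantsToCuspidal, LinearMap.comp_apply, LinearEquiv.coe_coe, torusInvariantsEquivGamma0,
    LinearEquiv.trans_apply,
    torusInvariantsEquiv_cosetClass_of_eq k p M hpM _ _ (componentMap_transferCycle k p M hpM hq hqp γ a),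
    Iso.toLinearEquiv_apply, transferCycleChain, map_sum, map_sum, map_sum, map_sum]
  refine Finset.sum_congr rfl fun i _ => ?_
  rw [torusLevelH1Iso_single]
  exact cuspidalClassMap_single (p ^ 2 * M) k _ a

/-- **The dictionary on the base coset class**: `torusInvariantsToCuspidal (cosetClass [γ ⊗ aδ_{T̃}]) = a·({∞,(δ⁻¹γδ)∞} ⊗ 1)`.
[cite: AshStevens1986, §1 (1.3); Knapp1993, Prop. 11.22] -/
theorem torusInvariantsToCuspidal_cosetClass_baseCycle [NeZero M] [NeZero (p ^ 2 * M)] (γ : torusLevel p M) (a : k) :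
    torusInvariantsToCuspidal k p M hpM (cosetClass k p M (baseCycle k p M γ a)) =
      a • Literature.NumberTheory.ModularSymbols.symbol (p ^ 2 * M) k (torusLevelEquiv p M hpM γ : Gamma0 (p ^ 2 * M)) :=
  torusInvariantsToCuspidal_cosetClass_of_eq_single k p M hpM _ γ a (componentMap_single_eq_baseCycle k p M γ a)

end FullLevel

end Literature.NumberTheory.ModularSymbols
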